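import Summits.NavierStokesRegularity.NavierStokesRegularity.Theorems.ExtremiserTransienceAxialPeriodWindows
import Literature.Analysis.FluidPDE.MildSolution
import Literature.Analysis.UnboundedOperators.HeatKernelBoundedData
import HarnessLib

/-!
# Route `ExtremiserTransience`, crux `NearExtremalTransiencePerFlow` (stmt-NavierStokesRegularity-26567), rung R1
# `PeriodicFilamentLiouville` of LINE g9-β `filament_selection` — TOOLS II: the strict `L^∞` contraction of the
# heat flow on axially periodic data with zero axial mean

Theorems file (`--supports stmt-NavierStokesRegularity-26567`; theorems only, no definitions), companion of
`ExtremiserTransienceAxialPeriodWindows`.  For `φ : ℝ³ → F` continuous, bounded by `B`, axially `ℓ`-periodic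
(`IsAxiallyPeriodic ℓ φ`) with ZERO AXIAL MEAN (`∫₀^ℓ φ (y + s e_z) ds = 0` for every `y`), the heat flow
`e^{hΔ} φ = heatFlow φ h` (the tree's Gauss–Weierstrass convolution) satisfies, for every `h > 0` and `x`,

  `‖(e^{hΔ} φ)(x)‖ ≤ (1 − (4πh)^{-3/2} e^{-ℓ²/(8h)} |B(0, ℓ/2)|) · B`

(`norm_heatFlow_le_mul_of_axialMean_zero`), a STRICT contraction (`heatFlowAxialFactor_lt_one`).  Proof: a
Doeblin-type minorisation of the kernel, `heatKernel h y ≥ κ(y) · 1{−ℓ/2 ≤ y₂ < ℓ/2}` with the axially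
invariant Gaussian weight `κ(y) = (4πh)^{-3/2} e^{-ℓ²/(16h)} e^{-r(y)²/(4h)}` (`window_weight_le_heatKernel`;
`‖y‖² = r² + y₂²`); the `κ`-part of `∫ heatKernel(y) φ(x − y) dy` vanishes by
`setIntegral_window_smul_eq_zero_of_axialMean_zero`, the remaining kernel has mass `1 − ∫ κ·1_{window}`, and
`∫ κ·1_{window} ≥ (4πh)^{-3/2} e^{-ℓ²/(8h)} |B(0, ℓ/2)|`.  No Fourier series and no product decomposition of
`ℝ³` are used.  Also: the axial line integral commutes with the heat flow
(`intervalIntegral_heatFlow_comp_add_smul`, Fubini).  These are the two heat-flow inputs of the `L^∞`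
mild-formulation proof that axially periodic Type-I ancient mild solutions of Navier–Stokes vanish (`ExtremiserTransienceTypeIAncientAxiallyPeriodicLiouville`); nothing here concerns Navier–Stokes; no summit is proved by a line. [folklore]

## Mathlib / tree search

Tree: `heatFlow`, `heatFlow_of_pos/of_nonpos` (`MildSolution`); `UnboundedOperators.heatKernel`,
`heatExtension_apply`, `integral_heatKernel_eq_one_holds`, `integrable_heatKernel_holds`, `heatKernel_pos`,
`continuous_heatKernel`, `integrable_heatKernel_smul_of_bound`; `ExtremiserTransienceAxialPeriodWindows`.  Mathlib:
`finrank_euclideanSpace_fin`, `integral_integral_swap`, `Integrable.mul_prod`, `integral_indicator_const`,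
`norm_integral_le_of_norm_le`.
-/

noncomputable section

open MeasureTheory Set Function Filter Metric intervalIntegral Topology
open Literature.Analysis Literature.Analysis.FluidPDE
open scoped RealInnerProductSpace ENNReal

namespace Summit.NavierStokesRegularity.NavierStokesRegularity.Theorems.AxiallyPeriodicLiouville
-- the summit's namespace `Summit.NavierStokesRegularity.NavierStokesRegularity` repeats the problem name by convention (D-0017)
set_option linter.dupNamespace false

variable {F : Type*} [NormedAddCommGroup F] [NormedSpace ℝ F]

/-! ### The strict `L^∞` contraction of the heat flow on axially periodic data with zero axial mean -/

/-- In `ℝ³` the Gauss–Weierstrass kernel is `(4πh)^{-3/2} e^{-‖y‖²/(4h)}`. [folklore] -/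
theorem heatKernel_eq_three (h : ℝ) (y : EuclideanSpace ℝ (Fin 3)) :
    UnboundedOperators.heatKernel h y = (4 * Real.pi * h) ^ (-(3 : ℝ) / 2) * Real.exp (-‖y‖ ^ 2 / (4 * h)) := by
  rw [UnboundedOperators.heatKernel, finrank_euclideanSpace_fin]
  norm_num

/-- **Doeblin minorant.** On the period window `{−ℓ/2 ≤ y₂ < ℓ/2}` the heat kernel dominates the axially
invariant Gaussian weight `(4πh)^{-3/2} e^{-ℓ²/(16h)} e^{-r(y)²/(4h)}` (`r` the cylindrical radius), since
`‖y‖² = r² + y₂² ≤ r² + ℓ²/4` there. [folklore] -/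
theorem window_weight_le_heatKernel {h ℓ : ℝ} (hh : 0 < h) {y : EuclideanSpace ℝ (Fin 3)}
    (hy : y 2 ∈ Ico (-(ℓ / 2)) (ℓ / 2)) :
    (4 * Real.pi * h) ^ (-(3 : ℝ) / 2) * Real.exp (-(ℓ ^ 2 / (16 * h))) *
        Real.exp (-(cylRadius y ^ 2 / (4 * h))) ≤ UnboundedOperators.heatKernel h y := by
  rw [heatKernel_eq_three, mul_assoc, ← Real.exp_add]
  refine mul_le_mul_of_nonneg_left (Real.exp_le_exp.2 ?_) (by positivity)
  have hsq : y 2 ^ 2 ≤ (ℓ / 2) ^ 2 := by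
    rw [← sq_abs]
    exact pow_le_pow_left₀ (abs_nonneg _) (abs_le.2 ⟨hy.1, hy.2.le⟩) 2
  have hns : ‖y‖ ^ 2 = cylRadius y ^ 2 + y 2 ^ 2 := by
    rw [EuclideanSpace.real_norm_sq_eq, cylRadius_sq, Fin.sum_univ_three]
  rw [hns]
  have h4 : 0 < 4 * h := by positivity
  have key : -(ℓ ^ 2 / (16 * h)) + -(cylRadius y ^ 2 / (4 * h)) = -(cylRadius y ^ 2 + (ℓ / 2) ^ 2) / (4 * h) := by
    field_simp
    ring
  rw [key, div_le_div_iff_of_pos_right h4]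
  linarith

/-- On a window `{c ≤ y₂ < d}` the axially invariant Gaussian weight is dominated by a multiple of the heat
kernel, `e^{-r(y)²/(4h)} ≤ e^{max(c², d²)/(4h)} · e^{-‖y‖²/(4h)}`; hence it is integrable on every period window.
[folklore] -/
theorem integrableOn_window_weight {h : ℝ} (hh : 0 < h) (A : ℝ) (c d : ℝ) :
    IntegrableOn (fun y : EuclideanSpace ℝ (Fin 3) => A * Real.exp (-(cylRadius y ^ 2 / (4 * h))))
      {y : EuclideanSpace ℝ (Fin 3) | y 2 ∈ Ico c d} := by
  set D : ℝ := max (c ^ 2) (d ^ 2) with hD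
  have hK : Integrable (fun y : EuclideanSpace ℝ (Fin 3) =>
      |A| * ((4 * Real.pi * h) ^ (-(3 : ℝ) / 2))⁻¹ * Real.exp (D / (4 * h)) * UnboundedOperators.heatKernel h y) :=
    (UnboundedOperators.integrable_heatKernel_holds hh).const_mul _
  refine (hK.restrict (s := {y : EuclideanSpace ℝ (Fin 3) | y 2 ∈ Ico c d})).mono' ?_ ?_
  · have hc : Continuous fun y : EuclideanSpace ℝ (Fin 3) => A * Real.exp (-(cylRadius y ^ 2 / (4 * h))) := by
      have := continuous_cylRadius
      fun_prop
    exact hc.aestronglyMeasurable.restrict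
  · rw [ae_restrict_iff' (measurableSet_window c d)]
    refine Eventually.of_forall fun y hy => ?_
    have hpos : 0 < (4 * Real.pi * h) ^ (-(3 : ℝ) / 2) := by positivity
    rw [heatKernel_eq_three, Real.norm_eq_abs, abs_mul, Real.abs_exp]
    have h4 : 0 < 4 * h := by positivity
    have hy2 : y 2 ^ 2 ≤ D := by
      simp only [mem_setOf_eq, mem_Ico] at hy
      rcases le_or_gt 0 (y 2) with h0 | h0
      · exact le_trans (pow_le_pow_left₀ h0 hy.2.le 2) (le_max_right _ _)
      · have : y 2 ^ 2 ≤ c ^ 2 := by nlinarith [hy.1]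
        exact le_trans this (le_max_left _ _)
    have hexp : Real.exp (-(cylRadius y ^ 2 / (4 * h))) ≤
        Real.exp (D / (4 * h)) * Real.exp (-‖y‖ ^ 2 / (4 * h)) := by
      rw [← Real.exp_add]
      refine Real.exp_le_exp.2 ?_
      have hns : ‖y‖ ^ 2 = cylRadius y ^ 2 + y 2 ^ 2 := by
        rw [EuclideanSpace.real_norm_sq_eq, cylRadius_sq, Fin.sum_univ_three]
      rw [hns, ← sub_nonneg]
      have : D / (4 * h) + -(cylRadius y ^ 2 + y 2 ^ 2) / (4 * h) - -(cylRadius y ^ 2 / (4 * h)) =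
          (D - y 2 ^ 2) / (4 * h) := by
        field_simp
        ring
      rw [this]
      exact div_nonneg (sub_nonneg.2 hy2) h4.le
    calc |A| * Real.exp (-(cylRadius y ^ 2 / (4 * h)))
        ≤ |A| * (Real.exp (D / (4 * h)) * Real.exp (-‖y‖ ^ 2 / (4 * h))) :=
          mul_le_mul_of_nonneg_left hexp (abs_nonneg _)
      _ = |A| * ((4 * Real.pi * h) ^ (-(3 : ℝ) / 2))⁻¹ * Real.exp (D / (4 * h)) *
            ((4 * Real.pi * h) ^ (-(3 : ℝ) / 2) * Real.exp (-‖y‖ ^ 2 / (4 * h))) := by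
          field_simp

/-- **Strict sup-norm contraction of the heat flow on axially periodic data with zero axial mean.**
If `φ : ℝ³ → F` is continuous, `‖φ‖ ≤ B`, axially `ℓ`-periodic and `∫₀^ℓ φ (y + s e_z) ds = 0` for all `y`,
then for every `h > 0` and every `x`,
`‖(e^{hΔ} φ)(x)‖ ≤ (1 − (4πh)^{-3/2} e^{-ℓ²/(8h)} |B(0, ℓ/2)|) · B`.
Proof: write the heat kernel as `(K − m) + m` with the Doeblin minorant `m = κ · 1{−ℓ/2 ≤ y₂ < ℓ/2}`
(`window_weight_le_heatKernel`); the `m`-part of `∫ K(y) φ(x−y) dy` vanishes by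
`setIntegral_window_smul_eq_zero_of_axialMean_zero`, the rest has mass `1 − ∫ m`, and
`∫ m ≥ (4πh)^{-3/2} e^{-ℓ²/(8h)} |B(0,ℓ/2)|` because `m` is at least that constant density on the ball
`B(0, ℓ/2)`. [folklore] -/
theorem norm_heatFlow_le_mul_of_axialMean_zero [CompleteSpace F] {ℓ h : ℝ} (hℓ : 0 < ℓ) (hh : 0 < h)
    {φ : EuclideanSpace ℝ (Fin 3) → F} (hφ : Continuous φ) {B : ℝ} (hB : ∀ y, ‖φ y‖ ≤ B)
    (hper : IsAxiallyPeriodic ℓ φ) (hmean : ∀ y, ∫ s in (0 : ℝ)..ℓ, φ (y + s • eZ) = 0)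
    (x : EuclideanSpace ℝ (Fin 3)) :
    ‖heatFlow φ h x‖ ≤ (1 - (4 * Real.pi * h) ^ (-(3 : ℝ) / 2) * Real.exp (-(ℓ ^ 2 / (8 * h))) *
        (volume (Metric.ball (0 : EuclideanSpace ℝ (Fin 3)) (ℓ / 2))).toReal) * B := by
  have hB0 : 0 ≤ B := (norm_nonneg _).trans (hB 0)
  rw [heatFlow_of_pos φ hh, UnboundedOperators.heatExtension_apply]
  -- notation
  set A : ℝ := (4 * Real.pi * h) ^ (-(3 : ℝ) / 2) * Real.exp (-(ℓ ^ 2 / (16 * h))) with hA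
  set c₀ : ℝ := (4 * Real.pi * h) ^ (-(3 : ℝ) / 2) * Real.exp (-(ℓ ^ 2 / (8 * h))) with hc₀
  set κ : EuclideanSpace ℝ (Fin 3) → ℝ := fun y => A * Real.exp (-(cylRadius y ^ 2 / (4 * h))) with hκ
  set W₀ : Set (EuclideanSpace ℝ (Fin 3)) := {y | y 2 ∈ Ico (-(ℓ / 2)) (ℓ / 2)} with hW₀
  set m : EuclideanSpace ℝ (Fin 3) → ℝ := W₀.indicator κ with hm
  set K : EuclideanSpace ℝ (Fin 3) → ℝ := fun y => UnboundedOperators.heatKernel h y with hK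
  set ψ : EuclideanSpace ℝ (Fin 3) → F := fun y => φ (x - y) with hψ
  have hW₀m : MeasurableSet W₀ := measurableSet_window _ _
  have hA0 : 0 ≤ A := by positivity
  have hκ_cont : Continuous κ := by
    have := continuous_cylRadius
    simp only [hκ]
    fun_prop
  have hκ_nonneg : ∀ y, 0 ≤ κ y := fun y => by positivity
  have hκ_inv : ∀ (y : EuclideanSpace ℝ (Fin 3)) (s : ℝ), κ (y + s • eZ) = κ y := by
    intro y s
    simp only [hκ, cylRadius_sq_add_smul_eZ]
  -- the minorant
  have hm_le : ∀ y, m y ≤ K y := by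
    intro y
    by_cases hy : y ∈ W₀
    · rw [hm, indicator_of_mem hy]
      have := window_weight_le_heatKernel hh (ℓ := ℓ) (y := y) hy
      simpa only [hκ, hA, mul_assoc] using this
    · rw [hm, indicator_of_notMem hy]
      exact (UnboundedOperators.heatKernel_pos hh y).le
  have hm_nonneg : ∀ y, 0 ≤ m y := fun y => by
    by_cases hy : y ∈ W₀
    · rw [hm, indicator_of_mem hy]; exact hκ_nonneg y
    · rw [hm, indicator_of_notMem hy]
  have hK_int : Integrable K := UnboundedOperators.integrable_heatKernel_holds hh
  have hm_meas : AEStronglyMeasurable m volume := (hκ_cont.aestronglyMeasurable).indicator hW₀m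
  have hm_int : Integrable m := by
    refine hK_int.mono' hm_meas (Eventually.of_forall fun y => ?_)
    rw [Real.norm_of_nonneg (hm_nonneg y)]
    exact hm_le y
  -- the data seen from `x`
  have hψ_cont : Continuous ψ := hφ.comp (continuous_const.sub continuous_id)
  have hψB : ∀ y, ‖ψ y‖ ≤ B := fun y => hB _
  have hψ_per : IsAxiallyPeriodic ℓ ψ := by
    intro y
    simp only [hψ]
    have : x - (y + ℓ • EuclideanSpace.single 2 1) = (x - y) - ℓ • eZ := by rw [eZ, sub_add_eq_sub_sub]
    rw [this, isAxiallyPeriodic_sub_period hper]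
  have hψ_mean : ∀ y, ∫ s in (0 : ℝ)..ℓ, ψ (y + s • eZ) = 0 := by
    intro y
    simp only [hψ]
    have : ∀ s : ℝ, x - (y + s • eZ) = (x - y) - s • eZ := fun s => sub_add_eq_sub_sub x y _
    simp_rw [this]
    rw [intervalIntegral_comp_sub_smul_eZ_of_isAxiallyPeriodic hper, hmean]
  -- integrability of the pieces
  have hKψ : Integrable fun y => K y • ψ y :=
    UnboundedOperators.integrable_heatKernel_smul_of_bound hφ hB hh x
  have hmψ : Integrable fun y => m y • ψ y := by
    refine (hm_int.norm.mul_const B).mono' (hm_meas.smul hψ_cont.aestronglyMeasurable)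
      (Eventually.of_forall fun y => ?_)
    rw [norm_smul]
    exact mul_le_mul_of_nonneg_left (hψB y) (norm_nonneg _)
  -- split the kernel
  have hsplit : ∫ y, K y • ψ y = (∫ y, (K y - m y) • ψ y) + ∫ y, m y • ψ y := by
    rw [← integral_add (hKψ.sub hmψ |>.congr ?_) hmψ]
    · refine integral_congr_ae (Eventually.of_forall fun y => ?_)
      simp only [sub_smul, sub_add_cancel]
    · exact Eventually.of_forall fun y => by simp only [Pi.sub_apply, sub_smul]
  -- the minorant part vanishes
  have hzero : ∫ y, m y • ψ y = 0 := by
    have h1 : (fun y => m y • ψ y) = W₀.indicator fun y => κ y • ψ y := by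
      funext y
      by_cases hy : y ∈ W₀
      · simp only [hm, indicator_of_mem hy]
      · simp only [hm, indicator_of_notMem hy, zero_smul]
    rw [h1, MeasureTheory.integral_indicator hW₀m]
    have hW₀' : W₀ = {y : EuclideanSpace ℝ (Fin 3) | y 2 ∈ Ico (-(ℓ / 2)) (-(ℓ / 2) + ℓ)} := by
      rw [show -(ℓ / 2) + ℓ = ℓ / 2 by ring]
    rw [hW₀']
    exact setIntegral_window_smul_eq_zero_of_axialMean_zero hℓ hκ_cont hκ_inv
      (fun c d => integrableOn_window_weight hh A c d) hψ_cont hψB hψ_per hψ_mean _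
  -- the rest has mass `1 − ∫ m`
  have hrest : ‖∫ y, (K y - m y) • ψ y‖ ≤ (1 - ∫ y, m y) * B := by
    have hint : Integrable fun y => (K y - m y) * B := (hK_int.sub hm_int).mul_const B
    calc ‖∫ y, (K y - m y) • ψ y‖ ≤ ∫ y, (K y - m y) * B := by
          refine norm_integral_le_of_norm_le hint (Eventually.of_forall fun y => ?_)
          rw [norm_smul, Real.norm_of_nonneg (sub_nonneg.2 (hm_le y))]
          exact mul_le_mul_of_nonneg_left (hψB y) (sub_nonneg.2 (hm_le y))
      _ = (1 - ∫ y, m y) * B := by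
          rw [MeasureTheory.integral_mul_const, integral_sub hK_int hm_int]
          simp only [hK, UnboundedOperators.integral_heatKernel_eq_one_holds hh]
  -- `∫ m ≥ c₀ |B(0, ℓ/2)|`
  have hball : ∀ y ∈ Metric.ball (0 : EuclideanSpace ℝ (Fin 3)) (ℓ / 2), c₀ ≤ m y := by
    intro y hy
    rw [Metric.mem_ball, dist_zero_right] at hy
    have habs : |y 2| < ℓ / 2 := by
      have h2 := PiLp.norm_apply_le y 2
      rw [Real.norm_eq_abs] at h2
      exact lt_of_le_of_lt h2 hy
    have hyW : y ∈ W₀ := by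
      simp only [hW₀, mem_setOf_eq, mem_Ico]
      exact ⟨(abs_lt.1 habs).1.le, (abs_lt.1 habs).2⟩
    rw [hm, indicator_of_mem hyW]
    simp only [hκ, hA, hc₀]
    have hr : cylRadius y ^ 2 ≤ (ℓ / 2) ^ 2 := by
      have h1 : cylRadius y ^ 2 ≤ ‖y‖ ^ 2 := by
        rw [EuclideanSpace.real_norm_sq_eq, cylRadius_sq, Fin.sum_univ_three]; nlinarith [sq_nonneg (y 2)]
      exact h1.trans (pow_le_pow_left₀ (norm_nonneg _) hy.le 2)
    have h4 : 0 < 4 * h := by positivity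
    have e1 : Real.exp (-(ℓ ^ 2 / (8 * h))) =
        Real.exp (-(ℓ ^ 2 / (16 * h))) * Real.exp (-((ℓ / 2) ^ 2 / (4 * h))) := by
      rw [← Real.exp_add]
      congr 1
      field_simp
      ring
    rw [e1, ← mul_assoc]
    refine mul_le_mul_of_nonneg_left (Real.exp_le_exp.2 ?_) (by positivity)
    rw [neg_le_neg_iff, div_le_div_iff_of_pos_right h4]
    exact hr
  have hmass : c₀ * (volume (Metric.ball (0 : EuclideanSpace ℝ (Fin 3)) (ℓ / 2))).toReal ≤ ∫ y, m y := by
    have hind : ∫ y, (Metric.ball (0 : EuclideanSpace ℝ (Fin 3)) (ℓ / 2)).indicator (fun _ => c₀) y =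
        (volume (Metric.ball (0 : EuclideanSpace ℝ (Fin 3)) (ℓ / 2))).toReal * c₀ := by
      rw [integral_indicator_const c₀ measurableSet_ball, smul_eq_mul, Measure.real]
    rw [mul_comm, ← hind]
    refine integral_mono ?_ hm_int fun y => ?_
    · exact (integrable_indicator_iff measurableSet_ball).2 (integrableOn_const measure_ball_lt_top.ne)
    · by_cases hy : y ∈ Metric.ball (0 : EuclideanSpace ℝ (Fin 3)) (ℓ / 2)
      · rw [indicator_of_mem hy]; exact hball y hy
      · rw [indicator_of_notMem hy]; exact hm_nonneg y
  -- assemble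
  calc ‖∫ y, K y • ψ y‖ = ‖∫ y, (K y - m y) • ψ y‖ := by rw [hsplit, hzero, add_zero]
    _ ≤ (1 - ∫ y, m y) * B := hrest
    _ ≤ (1 - c₀ * (volume (Metric.ball (0 : EuclideanSpace ℝ (Fin 3)) (ℓ / 2))).toReal) * B := by
        gcongr

/-- The contraction factor of `norm_heatFlow_le_mul_of_axialMean_zero` is strictly less than one.
[folklore] -/
theorem heatFlowAxialFactor_lt_one {ℓ h : ℝ} (hℓ : 0 < ℓ) (hh : 0 < h) :
    1 - (4 * Real.pi * h) ^ (-(3 : ℝ) / 2) * Real.exp (-(ℓ ^ 2 / (8 * h))) *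
        (volume (Metric.ball (0 : EuclideanSpace ℝ (Fin 3)) (ℓ / 2))).toReal < 1 := by
  have hvol : 0 < (volume (Metric.ball (0 : EuclideanSpace ℝ (Fin 3)) (ℓ / 2))).toReal :=
    ENNReal.toReal_pos (Metric.measure_ball_pos volume _ (by positivity)).ne' measure_ball_lt_top.ne
  have : 0 < (4 * Real.pi * h) ^ (-(3 : ℝ) / 2) * Real.exp (-(ℓ ^ 2 / (8 * h))) *
      (volume (Metric.ball (0 : EuclideanSpace ℝ (Fin 3)) (ℓ / 2))).toReal := by positivity
  linarith

/-! ### The axial line integral commutes with the heat flow -/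

/-- **The axial line integral commutes with the heat flow**: for continuous bounded `g`,
`∫ₐᵇ (e^{τΔ} g)(x + s v) ds = (e^{τΔ} (z ↦ ∫ₐᵇ g (z + s v) ds))(x)` (`a ≤ b`; Fubini against the integrable heat
kernel, and translation covariance of the convolution). [folklore] -/
theorem intervalIntegral_heatFlow_comp_add_smul [CompleteSpace F] {g : EuclideanSpace ℝ (Fin 3) → F}
    (hg : Continuous g) {B : ℝ} (hB : ∀ z, ‖g z‖ ≤ B) (τ : ℝ) (x v : EuclideanSpace ℝ (Fin 3)) {a b : ℝ}
    (hab : a ≤ b) :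
    ∫ s in a..b, heatFlow g τ (x + s • v) = heatFlow (fun z => ∫ s in a..b, g (z + s • v)) τ x := by
  rcases le_or_gt τ 0 with hτ | hτ
  · simp only [heatFlow_of_nonpos _ hτ]
  rw [heatFlow_of_pos _ hτ, heatFlow_of_pos _ hτ, UnboundedOperators.heatExtension_apply]
  simp only [UnboundedOperators.heatExtension_apply]
  -- Fubini on `(a, b] × ℝ³`
  rw [intervalIntegral.integral_of_le hab]
  haveI : IsFiniteMeasure ((volume : Measure ℝ).restrict (Ioc a b)) :=
    isFiniteMeasure_restrict.2 measure_Ioc_lt_top.ne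
  have hK : Integrable (fun y : EuclideanSpace ℝ (Fin 3) => UnboundedOperators.heatKernel τ y * B) :=
    (UnboundedOperators.integrable_heatKernel_holds hτ).mul_const B
  have hdom : Integrable (fun p : ℝ × EuclideanSpace ℝ (Fin 3) => (1 : ℝ) * (UnboundedOperators.heatKernel τ p.2 * B))
      (((volume : Measure ℝ).restrict (Ioc a b)).prod volume) :=
    Integrable.mul_prod (integrable_const (1 : ℝ)) hK
  have hint : Integrable (uncurry fun (s : ℝ) (y : EuclideanSpace ℝ (Fin 3)) =>
      UnboundedOperators.heatKernel τ y • g (x + s • v - y)) (((volume : Measure ℝ).restrict (Ioc a b)).prod volume) := by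
    refine hdom.mono' ?_ (Eventually.of_forall fun p => ?_)
    · have hc : Continuous (uncurry fun (s : ℝ) (y : EuclideanSpace ℝ (Fin 3)) =>
          UnboundedOperators.heatKernel τ y • g (x + s • v - y)) := by
        have h1 : Continuous fun p : ℝ × EuclideanSpace ℝ (Fin 3) => x + p.1 • v - p.2 := by fun_prop
        exact ((UnboundedOperators.continuous_heatKernel τ).comp continuous_snd).smul (hg.comp h1)
      exact hc.aestronglyMeasurable
    · simp only [uncurry, norm_smul, one_mul, Real.norm_of_nonneg (UnboundedOperators.heatKernel_pos hτ _).le]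
      exact mul_le_mul_of_nonneg_left (hB _) (UnboundedOperators.heatKernel_pos hτ _).le
  rw [integral_integral_swap hint]
  refine integral_congr_ae (Eventually.of_forall fun y => ?_)
  simp only
  rw [MeasureTheory.integral_smul, ← intervalIntegral.integral_of_le hab]
  congr 1
  refine intervalIntegral.integral_congr fun s _ => ?_
  simp only [add_sub_right_comm]

end Summit.NavierStokesRegularity.NavierStokesRegularity.Theorems.AxiallyPeriodicLiouville

end
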